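/-
Copyright: the b2b-balaban T⁴-continuum CRUX team, row NE7b OWNER lineage `t4-ne7b-p1` (gen 146). Project licence.
-/
import Mathlib.Analysis.SpecialFunctions.Pow.Real
import Mathlib.Tactic.Positivity
import Mathlib.Tactic.Linarith
import Mathlib.Tactic.Ring

/-!
# ORDER FIVE BY CUTS UNDER THE FULL-GRAPH WEIGHT — THE WEIGHTED GREEDY INDUCTION (SCOPING-d17 §F, the five-point term of `M₅` in the
# WEIGHTED class).  (537)∕(539) turned the fifteen cut bounds `|u₅| ≤ C·(max_{e crossing S} q_e)⁴` into `|u₅| ≤ C·t⋆⁴ ≤ C·G_r(q)` (rooted greedy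
# polynomial) and (538)∕(558) summed `G_r` over the free sites.  The weighted slot letters need `t⋆⁴` against the FULL-GRAPH weight
# `Π_{10 pairs}ϑ`, which no single cut controls.  THIS FILE replays the greedy induction WITH THE PAIRS AS CURRENCY: for a kernel `r₁ ≥ 1`,
# symmetric and submultiplicative on sites, and `t ≥ 0` such that EVERY cut `S ∋ x₁` is crossed by a pair with `t·r₁(a,b)⁸ ≤ 1`,
#   `t⁴ · Π_{10 pairs p} r₁(p) ≤ 1`,   i.e.   `t⋆⁴ ≤ Π_{pairs} r₁⁻¹`   (next file, with `t·r₁⁸ ≤ 1` from `t ≤ r⁻¹` and `r₁⁸ ≤ r`).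
# INDUCTION on the reached set `S` (claim `t^{5−|S|}·O_S ≤ P_S^{N}`, `O_S`∕`P_S` the products over pairs leaving ∕ inside `S`, `N = 1, 3, 7, 15` at
# `|S| = 4, 3, 2, 1`): a strong pair `(a,b)` attaches `b`; its `|S|` links are carried to `a` (`r₁(c,b) ≤ r₁(c,a)r₁(a,b)`), so
# `Π_{c∈S} r₁(c,b) ≤ r₁(a,b)^{|S|}·P_S`, and `|S|·(N_{|S|+1}+1) ≤ 8` closes the step (`step`).  ONE lemma per level with the sites as arguments
# (relabelling covers the fifteen subsets), then the assembly over the fifteen cuts (row NE7b, node U5c; Mathlib only; [folklore]).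

Cell `pub-balaban`, sub-cell `t4`, spine estimate NE7b (`T4WeightBudget.RelWeightBound`; the cell's OWN estimate — NOT PRINTED in
[Bałaban 1983–89], NOT PROVED).  Crux-route work under `Spine/NE7b/` by the row OWNER (`t4-ne7b-p1` gen 146, file (681)) under FREEZE
(0)'s crux-prover clause; NOTHING of Bałaban's is named as a Lean object, valued or asserted; no `T4Continuum/Support` leaf typed; no
`def`, no notation (every product WRITTEN OUT); zero `sorry`.  Imports: Mathlib only (fast lane).

WHAT IS PROVED ([folklore]): **`step`**, **`cut_level4`**, **`cut_level3`** (levels two and one + the assembly are the next file); toy.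

HONEST (what this is NOT).  Finite algebra; the assembly from the fifteen written-out cut maxima of (557)∕(610) (`t⋆`) and the weighted slot sums
are the next files; the exponent `8` is the crude routing's price (`|S|(N+1) ≤ 8`), not optimised.  Scalar skeleton ((A3), NC-NE7b-α UNRULED);
nothing of Bałaban's asserted.  BY-NAME EFFECT ON THE WALL: NONE.  NE7b NOT PRINTED ∕ NOT PROVED; spine PROVED 0∕9; rung (B)+1 — the programme's
measures remain FINITE-torus statements; NOT the mass gap, NOT Clay.  HONEST DEPENDENCY: continuum YM on T⁴ ⇐ BetaPertH ∧ nine spine estimates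
(0∕9 proved); BetaPertH ⇐ (D1) ∧ (D4) ∧ CAP+tail; G-an2-4 gates asym, D1 and NE2∕3∕4.
-/

set_option autoImplicit false

namespace Summit.QuantumFields.BalabanUV.T4Continuum.NE7b.SupFivePointCutFullGraph

/-! ## §1. The weighted greedy step -/

/-- **The weighted greedy step**: at a reached set with inside product `P ≥ 1`, a strong pair `E` (`t·E⁸ ≤ 1`), the new site's links
`Pb ≤ Eᵏ·P` to the `k` reached sites, and the claim one level up (`tᵐ·O′ ≤ (P·Pb)^N`), the claim `t^{m+1}·(Pb·O′) ≤ P^{2N+1}` follows when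
`k(N+1) ≤ 8`. [folklore] -/
theorem step {t E Pb P O' : ℝ} {k N m : ℕ} (ht : 0 ≤ t) (hE : 1 ≤ E) (hP : 1 ≤ P) (hPb0 : 0 ≤ Pb) (hcut : t * E ^ 8 ≤ 1)
    (hkN : k * (N + 1) ≤ 8) (hPbE : Pb ≤ E ^ k * P) (hIH : t ^ m * O' ≤ (P * Pb) ^ N) :
    t ^ (m + 1) * (Pb * O') ≤ P ^ (2 * N + 1) := by
  have hP0 : 0 ≤ P := zero_le_one.trans hP
  have hE0 : 0 ≤ E := zero_le_one.trans hE
  calc t ^ (m + 1) * (Pb * O') = t * Pb * (t ^ m * O') := by ring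
    _ ≤ t * Pb * (P * Pb) ^ N := mul_le_mul_of_nonneg_left hIH (mul_nonneg ht hPb0)
    _ = t * (Pb ^ (N + 1) * P ^ N) := by ring
    _ ≤ t * ((E ^ k * P) ^ (N + 1) * P ^ N) :=
        mul_le_mul_of_nonneg_left (mul_le_mul_of_nonneg_right (pow_le_pow_left₀ hPb0 hPbE _) (pow_nonneg hP0 _)) ht
    _ = (t * E ^ (k * (N + 1))) * P ^ (2 * N + 1) := by ring
    _ ≤ (t * E ^ 8) * P ^ (2 * N + 1) := mul_le_mul_of_nonneg_right (mul_le_mul_of_nonneg_left (pow_le_pow_right₀ hE hkN) ht) (pow_nonneg hP0 _)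
    _ ≤ 1 * P ^ (2 * N + 1) := mul_le_mul_of_nonneg_right hcut (pow_nonneg hP0 _)
    _ = P ^ (2 * N + 1) := one_mul _

/-! ## §2. The four levels (sites as arguments) -/

variable {ι : Type} {r₁ : ι → ι → ℝ} {t : ℝ}

set_option maxHeartbeats 800000 in
/-- **Level four** (`|S| = 4`, one site outside): a strong pair across the cut gives `t·Π_{a∈S} r₁(a,m) ≤ Π_{pairs ⊂ S} r₁`. [folklore] -/
theorem cut_level4 (ht : 0 ≤ t) (h1 : ∀ x y, 1 ≤ r₁ x y) (hsymm : ∀ x y, r₁ x y = r₁ y x) (hmul : ∀ x y z, r₁ x z ≤ r₁ x y * r₁ y z)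
    (a1 a2 a3 a4 b1 : ι) (hcut : t * r₁ a1 b1 ^ 8 ≤ 1 ∨ t * r₁ a2 b1 ^ 8 ≤ 1 ∨ t * r₁ a3 b1 ^ 8 ≤ 1 ∨ t * r₁ a4 b1 ^ 8 ≤ 1)
     :
    t ^ 1 * (r₁ a1 b1 * r₁ a2 b1 * r₁ a3 b1 * r₁ a4 b1) ≤ (r₁ a1 a2 * r₁ a1 a3 * r₁ a1 a4 * r₁ a2 a3 * r₁ a2 a4 * r₁ a3 a4) ^ 1 := by
  have h0 : ∀ a b, 0 ≤ r₁ a b := fun a b => zero_le_one.trans (h1 a b)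
  have hm00 : ∀ a c b, r₁ a b ≤ r₁ a c * r₁ c b := fun a c b => hmul a c b
  have hm10 : ∀ a c b, r₁ a b ≤ r₁ c a * r₁ c b := fun a c b => by rw [hsymm c a]; exact hmul a c b
  rcases hcut with h | h | h | h
  · -- strong pair (a1,b1)
    have ih' : t ^ 0 * (1 : ℝ) ≤ ((r₁ a1 a2 * r₁ a1 a3 * r₁ a1 a4 * r₁ a2 a3 * r₁ a2 a4 * r₁ a3 a4) * (r₁ a1 b1 * r₁ a2 b1 * r₁ a3 b1 * r₁ a4 b1))
          ^ 0 := by norm_num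
    have hsub : r₁ a1 a2 * r₁ a1 a3 * r₁ a1 a4 ≤ r₁ a1 a2 * r₁ a1 a3 * r₁ a1 a4 * r₁ a2 a3 * r₁ a2 a4 * r₁ a3 a4 := by
      have hx : 0 ≤ r₁ a1 a2 * r₁ a1 a3 * r₁ a1 a4 := (mul_nonneg (mul_nonneg (h0 _ _) (h0 _ _)) (h0 _ _))
      have hrest : 1 ≤ r₁ a2 a3 * r₁ a2 a4 * r₁ a3 a4 := (one_le_mul_of_one_le_of_one_le (one_le_mul_of_one_le_of_one_le (h1 _ _) (h1 _ _)) (h1 _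
            _))
      calc r₁ a1 a2 * r₁ a1 a3 * r₁ a1 a4
          _ ≤ (r₁ a1 a2 * r₁ a1 a3 * r₁ a1 a4) * (r₁ a2 a3 * r₁ a2 a4 * r₁ a3 a4) := le_mul_of_one_le_right hx hrest
          _ = r₁ a1 a2 * r₁ a1 a3 * r₁ a1 a4 * r₁ a2 a3 * r₁ a2 a4 * r₁ a3 a4 := by ring
    have hch : r₁ a2 b1 * r₁ a3 b1 * r₁ a4 b1 ≤ (r₁ a1 a2 * r₁ a1 b1) * (r₁ a1 a3 * r₁ a1 b1) * (r₁ a1 a4 * r₁ a1 b1) :=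
      (mul_le_mul (mul_le_mul (hm10 a2 a1 b1) (hm10 a3 a1 b1) (h0 _ _) (mul_nonneg (h0 _ _) (h0 _ _))) (hm10 a4 a1 b1) (h0 _ _) (mul_nonneg
            (mul_nonneg (h0 _ _) (h0 _ _)) (mul_nonneg (h0 _ _) (h0 _ _))))
    have hPbE : r₁ a1 b1 * r₁ a2 b1 * r₁ a3 b1 * r₁ a4 b1 ≤ r₁ a1 b1 ^ 4 * (r₁ a1 a2 * r₁ a1 a3 * r₁ a1 a4 * r₁ a2 a3 * r₁ a2 a4 * r₁ a3 a4) := by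
      calc r₁ a1 b1 * r₁ a2 b1 * r₁ a3 b1 * r₁ a4 b1
          _ = r₁ a1 b1 * (r₁ a2 b1 * r₁ a3 b1 * r₁ a4 b1) := by ring
          _ ≤ r₁ a1 b1 * ((r₁ a1 a2 * r₁ a1 b1) * (r₁ a1 a3 * r₁ a1 b1) * (r₁ a1 a4 * r₁ a1 b1)) := mul_le_mul_of_nonneg_left hch (h0 _ _)
          _ = r₁ a1 b1 ^ 4 * (r₁ a1 a2 * r₁ a1 a3 * r₁ a1 a4) := by ring
          _ ≤ r₁ a1 b1 ^ 4 * (r₁ a1 a2 * r₁ a1 a3 * r₁ a1 a4 * r₁ a2 a3 * r₁ a2 a4 * r₁ a3 a4) := mul_le_mul_of_nonneg_left hsub (pow_nonneg (h0 _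
                _) _)
    have hs := step ht (h1 a1 b1) (one_le_mul_of_one_le_of_one_le (one_le_mul_of_one_le_of_one_le (one_le_mul_of_one_le_of_one_le
          (one_le_mul_of_one_le_of_one_le (one_le_mul_of_one_le_of_one_le (h1 _ _) (h1 _ _)) (h1 _ _)) (h1 _ _)) (h1 _ _)) (h1 _ _)) (mul_nonneg
          (mul_nonneg (mul_nonneg (h0 _ _) (h0 _ _)) (h0 _ _)) (h0 _ _)) h (by norm_num : 4 * (0 + 1) ≤ 8) hPbE ih'
    calc t ^ 1 * (r₁ a1 b1 * r₁ a2 b1 * r₁ a3 b1 * r₁ a4 b1)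
        _ = t ^ (0 + 1) * ((r₁ a1 b1 * r₁ a2 b1 * r₁ a3 b1 * r₁ a4 b1) * (1 : ℝ)) := by ring
        _ ≤ _ := hs
        _ = (r₁ a1 a2 * r₁ a1 a3 * r₁ a1 a4 * r₁ a2 a3 * r₁ a2 a4 * r₁ a3 a4) ^ 1 := by norm_num
  · -- strong pair (a2,b1)
    have ih' : t ^ 0 * (1 : ℝ) ≤ ((r₁ a1 a2 * r₁ a1 a3 * r₁ a1 a4 * r₁ a2 a3 * r₁ a2 a4 * r₁ a3 a4) * (r₁ a1 b1 * r₁ a2 b1 * r₁ a3 b1 * r₁ a4 b1))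
          ^ 0 := by norm_num
    have hsub : r₁ a1 a2 * r₁ a2 a3 * r₁ a2 a4 ≤ r₁ a1 a2 * r₁ a1 a3 * r₁ a1 a4 * r₁ a2 a3 * r₁ a2 a4 * r₁ a3 a4 := by
      have hx : 0 ≤ r₁ a1 a2 * r₁ a2 a3 * r₁ a2 a4 := (mul_nonneg (mul_nonneg (h0 _ _) (h0 _ _)) (h0 _ _))
      have hrest : 1 ≤ r₁ a1 a3 * r₁ a1 a4 * r₁ a3 a4 := (one_le_mul_of_one_le_of_one_le (one_le_mul_of_one_le_of_one_le (h1 _ _) (h1 _ _)) (h1 _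
            _))
      calc r₁ a1 a2 * r₁ a2 a3 * r₁ a2 a4
          _ ≤ (r₁ a1 a2 * r₁ a2 a3 * r₁ a2 a4) * (r₁ a1 a3 * r₁ a1 a4 * r₁ a3 a4) := le_mul_of_one_le_right hx hrest
          _ = r₁ a1 a2 * r₁ a1 a3 * r₁ a1 a4 * r₁ a2 a3 * r₁ a2 a4 * r₁ a3 a4 := by ring
    have hch : r₁ a1 b1 * r₁ a3 b1 * r₁ a4 b1 ≤ (r₁ a1 a2 * r₁ a2 b1) * (r₁ a2 a3 * r₁ a2 b1) * (r₁ a2 a4 * r₁ a2 b1) :=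
      (mul_le_mul (mul_le_mul (hm00 a1 a2 b1) (hm10 a3 a2 b1) (h0 _ _) (mul_nonneg (h0 _ _) (h0 _ _))) (hm10 a4 a2 b1) (h0 _ _) (mul_nonneg
            (mul_nonneg (h0 _ _) (h0 _ _)) (mul_nonneg (h0 _ _) (h0 _ _))))
    have hPbE : r₁ a1 b1 * r₁ a2 b1 * r₁ a3 b1 * r₁ a4 b1 ≤ r₁ a2 b1 ^ 4 * (r₁ a1 a2 * r₁ a1 a3 * r₁ a1 a4 * r₁ a2 a3 * r₁ a2 a4 * r₁ a3 a4) := by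
      calc r₁ a1 b1 * r₁ a2 b1 * r₁ a3 b1 * r₁ a4 b1
          _ = r₁ a2 b1 * (r₁ a1 b1 * r₁ a3 b1 * r₁ a4 b1) := by ring
          _ ≤ r₁ a2 b1 * ((r₁ a1 a2 * r₁ a2 b1) * (r₁ a2 a3 * r₁ a2 b1) * (r₁ a2 a4 * r₁ a2 b1)) := mul_le_mul_of_nonneg_left hch (h0 _ _)
          _ = r₁ a2 b1 ^ 4 * (r₁ a1 a2 * r₁ a2 a3 * r₁ a2 a4) := by ring
          _ ≤ r₁ a2 b1 ^ 4 * (r₁ a1 a2 * r₁ a1 a3 * r₁ a1 a4 * r₁ a2 a3 * r₁ a2 a4 * r₁ a3 a4) := mul_le_mul_of_nonneg_left hsub (pow_nonneg (h0 _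
                _) _)
    have hs := step ht (h1 a2 b1) (one_le_mul_of_one_le_of_one_le (one_le_mul_of_one_le_of_one_le (one_le_mul_of_one_le_of_one_le
          (one_le_mul_of_one_le_of_one_le (one_le_mul_of_one_le_of_one_le (h1 _ _) (h1 _ _)) (h1 _ _)) (h1 _ _)) (h1 _ _)) (h1 _ _)) (mul_nonneg
          (mul_nonneg (mul_nonneg (h0 _ _) (h0 _ _)) (h0 _ _)) (h0 _ _)) h (by norm_num : 4 * (0 + 1) ≤ 8) hPbE ih'
    calc t ^ 1 * (r₁ a1 b1 * r₁ a2 b1 * r₁ a3 b1 * r₁ a4 b1)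
        _ = t ^ (0 + 1) * ((r₁ a1 b1 * r₁ a2 b1 * r₁ a3 b1 * r₁ a4 b1) * (1 : ℝ)) := by ring
        _ ≤ _ := hs
        _ = (r₁ a1 a2 * r₁ a1 a3 * r₁ a1 a4 * r₁ a2 a3 * r₁ a2 a4 * r₁ a3 a4) ^ 1 := by norm_num
  · -- strong pair (a3,b1)
    have ih' : t ^ 0 * (1 : ℝ) ≤ ((r₁ a1 a2 * r₁ a1 a3 * r₁ a1 a4 * r₁ a2 a3 * r₁ a2 a4 * r₁ a3 a4) * (r₁ a1 b1 * r₁ a2 b1 * r₁ a3 b1 * r₁ a4 b1))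
          ^ 0 := by norm_num
    have hsub : r₁ a1 a3 * r₁ a2 a3 * r₁ a3 a4 ≤ r₁ a1 a2 * r₁ a1 a3 * r₁ a1 a4 * r₁ a2 a3 * r₁ a2 a4 * r₁ a3 a4 := by
      have hx : 0 ≤ r₁ a1 a3 * r₁ a2 a3 * r₁ a3 a4 := (mul_nonneg (mul_nonneg (h0 _ _) (h0 _ _)) (h0 _ _))
      have hrest : 1 ≤ r₁ a1 a2 * r₁ a1 a4 * r₁ a2 a4 := (one_le_mul_of_one_le_of_one_le (one_le_mul_of_one_le_of_one_le (h1 _ _) (h1 _ _)) (h1 _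
            _))
      calc r₁ a1 a3 * r₁ a2 a3 * r₁ a3 a4
          _ ≤ (r₁ a1 a3 * r₁ a2 a3 * r₁ a3 a4) * (r₁ a1 a2 * r₁ a1 a4 * r₁ a2 a4) := le_mul_of_one_le_right hx hrest
          _ = r₁ a1 a2 * r₁ a1 a3 * r₁ a1 a4 * r₁ a2 a3 * r₁ a2 a4 * r₁ a3 a4 := by ring
    have hch : r₁ a1 b1 * r₁ a2 b1 * r₁ a4 b1 ≤ (r₁ a1 a3 * r₁ a3 b1) * (r₁ a2 a3 * r₁ a3 b1) * (r₁ a3 a4 * r₁ a3 b1) :=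
      (mul_le_mul (mul_le_mul (hm00 a1 a3 b1) (hm00 a2 a3 b1) (h0 _ _) (mul_nonneg (h0 _ _) (h0 _ _))) (hm10 a4 a3 b1) (h0 _ _) (mul_nonneg
            (mul_nonneg (h0 _ _) (h0 _ _)) (mul_nonneg (h0 _ _) (h0 _ _))))
    have hPbE : r₁ a1 b1 * r₁ a2 b1 * r₁ a3 b1 * r₁ a4 b1 ≤ r₁ a3 b1 ^ 4 * (r₁ a1 a2 * r₁ a1 a3 * r₁ a1 a4 * r₁ a2 a3 * r₁ a2 a4 * r₁ a3 a4) := by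
      calc r₁ a1 b1 * r₁ a2 b1 * r₁ a3 b1 * r₁ a4 b1
          _ = r₁ a3 b1 * (r₁ a1 b1 * r₁ a2 b1 * r₁ a4 b1) := by ring
          _ ≤ r₁ a3 b1 * ((r₁ a1 a3 * r₁ a3 b1) * (r₁ a2 a3 * r₁ a3 b1) * (r₁ a3 a4 * r₁ a3 b1)) := mul_le_mul_of_nonneg_left hch (h0 _ _)
          _ = r₁ a3 b1 ^ 4 * (r₁ a1 a3 * r₁ a2 a3 * r₁ a3 a4) := by ring
          _ ≤ r₁ a3 b1 ^ 4 * (r₁ a1 a2 * r₁ a1 a3 * r₁ a1 a4 * r₁ a2 a3 * r₁ a2 a4 * r₁ a3 a4) := mul_le_mul_of_nonneg_left hsub (pow_nonneg (h0 _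
                _) _)
    have hs := step ht (h1 a3 b1) (one_le_mul_of_one_le_of_one_le (one_le_mul_of_one_le_of_one_le (one_le_mul_of_one_le_of_one_le
          (one_le_mul_of_one_le_of_one_le (one_le_mul_of_one_le_of_one_le (h1 _ _) (h1 _ _)) (h1 _ _)) (h1 _ _)) (h1 _ _)) (h1 _ _)) (mul_nonneg
          (mul_nonneg (mul_nonneg (h0 _ _) (h0 _ _)) (h0 _ _)) (h0 _ _)) h (by norm_num : 4 * (0 + 1) ≤ 8) hPbE ih'
    calc t ^ 1 * (r₁ a1 b1 * r₁ a2 b1 * r₁ a3 b1 * r₁ a4 b1)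
        _ = t ^ (0 + 1) * ((r₁ a1 b1 * r₁ a2 b1 * r₁ a3 b1 * r₁ a4 b1) * (1 : ℝ)) := by ring
        _ ≤ _ := hs
        _ = (r₁ a1 a2 * r₁ a1 a3 * r₁ a1 a4 * r₁ a2 a3 * r₁ a2 a4 * r₁ a3 a4) ^ 1 := by norm_num
  · -- strong pair (a4,b1)
    have ih' : t ^ 0 * (1 : ℝ) ≤ ((r₁ a1 a2 * r₁ a1 a3 * r₁ a1 a4 * r₁ a2 a3 * r₁ a2 a4 * r₁ a3 a4) * (r₁ a1 b1 * r₁ a2 b1 * r₁ a3 b1 * r₁ a4 b1))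
          ^ 0 := by norm_num
    have hsub : r₁ a1 a4 * r₁ a2 a4 * r₁ a3 a4 ≤ r₁ a1 a2 * r₁ a1 a3 * r₁ a1 a4 * r₁ a2 a3 * r₁ a2 a4 * r₁ a3 a4 := by
      have hx : 0 ≤ r₁ a1 a4 * r₁ a2 a4 * r₁ a3 a4 := (mul_nonneg (mul_nonneg (h0 _ _) (h0 _ _)) (h0 _ _))
      have hrest : 1 ≤ r₁ a1 a2 * r₁ a1 a3 * r₁ a2 a3 := (one_le_mul_of_one_le_of_one_le (one_le_mul_of_one_le_of_one_le (h1 _ _) (h1 _ _)) (h1 _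
            _))
      calc r₁ a1 a4 * r₁ a2 a4 * r₁ a3 a4
          _ ≤ (r₁ a1 a4 * r₁ a2 a4 * r₁ a3 a4) * (r₁ a1 a2 * r₁ a1 a3 * r₁ a2 a3) := le_mul_of_one_le_right hx hrest
          _ = r₁ a1 a2 * r₁ a1 a3 * r₁ a1 a4 * r₁ a2 a3 * r₁ a2 a4 * r₁ a3 a4 := by ring
    have hch : r₁ a1 b1 * r₁ a2 b1 * r₁ a3 b1 ≤ (r₁ a1 a4 * r₁ a4 b1) * (r₁ a2 a4 * r₁ a4 b1) * (r₁ a3 a4 * r₁ a4 b1) :=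
      (mul_le_mul (mul_le_mul (hm00 a1 a4 b1) (hm00 a2 a4 b1) (h0 _ _) (mul_nonneg (h0 _ _) (h0 _ _))) (hm00 a3 a4 b1) (h0 _ _) (mul_nonneg
            (mul_nonneg (h0 _ _) (h0 _ _)) (mul_nonneg (h0 _ _) (h0 _ _))))
    have hPbE : r₁ a1 b1 * r₁ a2 b1 * r₁ a3 b1 * r₁ a4 b1 ≤ r₁ a4 b1 ^ 4 * (r₁ a1 a2 * r₁ a1 a3 * r₁ a1 a4 * r₁ a2 a3 * r₁ a2 a4 * r₁ a3 a4) := by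
      calc r₁ a1 b1 * r₁ a2 b1 * r₁ a3 b1 * r₁ a4 b1
          _ = r₁ a4 b1 * (r₁ a1 b1 * r₁ a2 b1 * r₁ a3 b1) := by ring
          _ ≤ r₁ a4 b1 * ((r₁ a1 a4 * r₁ a4 b1) * (r₁ a2 a4 * r₁ a4 b1) * (r₁ a3 a4 * r₁ a4 b1)) := mul_le_mul_of_nonneg_left hch (h0 _ _)
          _ = r₁ a4 b1 ^ 4 * (r₁ a1 a4 * r₁ a2 a4 * r₁ a3 a4) := by ring
          _ ≤ r₁ a4 b1 ^ 4 * (r₁ a1 a2 * r₁ a1 a3 * r₁ a1 a4 * r₁ a2 a3 * r₁ a2 a4 * r₁ a3 a4) := mul_le_mul_of_nonneg_left hsub (pow_nonneg (h0 _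
                _) _)
    have hs := step ht (h1 a4 b1) (one_le_mul_of_one_le_of_one_le (one_le_mul_of_one_le_of_one_le (one_le_mul_of_one_le_of_one_le
          (one_le_mul_of_one_le_of_one_le (one_le_mul_of_one_le_of_one_le (h1 _ _) (h1 _ _)) (h1 _ _)) (h1 _ _)) (h1 _ _)) (h1 _ _)) (mul_nonneg
          (mul_nonneg (mul_nonneg (h0 _ _) (h0 _ _)) (h0 _ _)) (h0 _ _)) h (by norm_num : 4 * (0 + 1) ≤ 8) hPbE ih'
    calc t ^ 1 * (r₁ a1 b1 * r₁ a2 b1 * r₁ a3 b1 * r₁ a4 b1)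
        _ = t ^ (0 + 1) * ((r₁ a1 b1 * r₁ a2 b1 * r₁ a3 b1 * r₁ a4 b1) * (1 : ℝ)) := by ring
        _ ≤ _ := hs
        _ = (r₁ a1 a2 * r₁ a1 a3 * r₁ a1 a4 * r₁ a2 a3 * r₁ a2 a4 * r₁ a3 a4) ^ 1 := by norm_num

set_option maxHeartbeats 800000 in
/-- **Level three** (`|S| = 3`): from the two level-four claims and a strong pair across the cut, `t²·O_S ≤ P_S³`. [folklore] -/
theorem cut_level3 (ht : 0 ≤ t) (h1 : ∀ x y, 1 ≤ r₁ x y) (hsymm : ∀ x y, r₁ x y = r₁ y x) (hmul : ∀ x y z, r₁ x z ≤ r₁ x y * r₁ y z)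
    (a1 a2 a3 b1 b2 : ι) (hcut : t * r₁ a1 b1 ^ 8 ≤ 1 ∨ t * r₁ a2 b1 ^ 8 ≤ 1 ∨ t * r₁ a3 b1 ^ 8 ≤ 1 ∨ t * r₁ a1 b2 ^ 8 ≤ 1 ∨ t * r₁ a2 b2 ^ 8 ≤ 1 ∨
          t * r₁ a3 b2 ^ 8 ≤ 1)
    (ih1 : t ^ 1 * (r₁ a1 b2 * r₁ a2 b2 * r₁ a3 b2 * r₁ b1 b2) ≤ (r₁ a1 a2 * r₁ a1 a3 * r₁ a1 b1 * r₁ a2 a3 * r₁ a2 b1 * r₁ a3 b1) ^ 1)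
    (ih2 : t ^ 1 * (r₁ a1 b1 * r₁ a2 b1 * r₁ a3 b1 * r₁ b2 b1) ≤ (r₁ a1 a2 * r₁ a1 a3 * r₁ a1 b2 * r₁ a2 a3 * r₁ a2 b2 * r₁ a3 b2) ^ 1) :
    t ^ 2 * (r₁ a1 b1 * r₁ a2 b1 * r₁ a3 b1 * r₁ a1 b2 * r₁ a2 b2 * r₁ a3 b2 * r₁ b1 b2) ≤ (r₁ a1 a2 * r₁ a1 a3 * r₁ a2 a3) ^ 3 := by
  have h0 : ∀ a b, 0 ≤ r₁ a b := fun a b => zero_le_one.trans (h1 a b)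
  have hm00 : ∀ a c b, r₁ a b ≤ r₁ a c * r₁ c b := fun a c b => hmul a c b
  have hm10 : ∀ a c b, r₁ a b ≤ r₁ c a * r₁ c b := fun a c b => by rw [hsymm c a]; exact hmul a c b
  rcases hcut with h | h | h | h | h | h
  · -- strong pair (a1,b1)
    have ih' : t ^ 1 * (r₁ a1 b2 * r₁ a2 b2 * r₁ a3 b2 * r₁ b1 b2) ≤ ((r₁ a1 a2 * r₁ a1 a3 * r₁ a2 a3) * (r₁ a1 b1 * r₁ a2 b1 * r₁ a3 b1)) ^ 1 :=
          ih1.trans_eq (by ring)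
    have hsub : r₁ a1 a2 * r₁ a1 a3 ≤ r₁ a1 a2 * r₁ a1 a3 * r₁ a2 a3 := by
      have hx : 0 ≤ r₁ a1 a2 * r₁ a1 a3 := (mul_nonneg (h0 _ _) (h0 _ _))
      have hrest : 1 ≤ r₁ a2 a3 := (h1 _ _)
      calc r₁ a1 a2 * r₁ a1 a3
          _ ≤ (r₁ a1 a2 * r₁ a1 a3) * (r₁ a2 a3) := le_mul_of_one_le_right hx hrest
          _ = r₁ a1 a2 * r₁ a1 a3 * r₁ a2 a3 := by ring
    have hch : r₁ a2 b1 * r₁ a3 b1 ≤ (r₁ a1 a2 * r₁ a1 b1) * (r₁ a1 a3 * r₁ a1 b1) :=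
      (mul_le_mul (hm10 a2 a1 b1) (hm10 a3 a1 b1) (h0 _ _) (mul_nonneg (h0 _ _) (h0 _ _)))
    have hPbE : r₁ a1 b1 * r₁ a2 b1 * r₁ a3 b1 ≤ r₁ a1 b1 ^ 3 * (r₁ a1 a2 * r₁ a1 a3 * r₁ a2 a3) := by
      calc r₁ a1 b1 * r₁ a2 b1 * r₁ a3 b1
          _ = r₁ a1 b1 * (r₁ a2 b1 * r₁ a3 b1) := by ring
          _ ≤ r₁ a1 b1 * ((r₁ a1 a2 * r₁ a1 b1) * (r₁ a1 a3 * r₁ a1 b1)) := mul_le_mul_of_nonneg_left hch (h0 _ _)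
          _ = r₁ a1 b1 ^ 3 * (r₁ a1 a2 * r₁ a1 a3) := by ring
          _ ≤ r₁ a1 b1 ^ 3 * (r₁ a1 a2 * r₁ a1 a3 * r₁ a2 a3) := mul_le_mul_of_nonneg_left hsub (pow_nonneg (h0 _ _) _)
    have hs := step ht (h1 a1 b1) (one_le_mul_of_one_le_of_one_le (one_le_mul_of_one_le_of_one_le (h1 _ _) (h1 _ _)) (h1 _ _)) (mul_nonneg
          (mul_nonneg (h0 _ _) (h0 _ _)) (h0 _ _)) h (by norm_num : 3 * (1 + 1) ≤ 8) hPbE ih'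
    calc t ^ 2 * (r₁ a1 b1 * r₁ a2 b1 * r₁ a3 b1 * r₁ a1 b2 * r₁ a2 b2 * r₁ a3 b2 * r₁ b1 b2)
        _ = t ^ (1 + 1) * ((r₁ a1 b1 * r₁ a2 b1 * r₁ a3 b1) * (r₁ a1 b2 * r₁ a2 b2 * r₁ a3 b2 * r₁ b1 b2)) := by ring
        _ ≤ _ := hs
        _ = (r₁ a1 a2 * r₁ a1 a3 * r₁ a2 a3) ^ 3 := by norm_num
  · -- strong pair (a2,b1)
    have ih' : t ^ 1 * (r₁ a1 b2 * r₁ a2 b2 * r₁ a3 b2 * r₁ b1 b2) ≤ ((r₁ a1 a2 * r₁ a1 a3 * r₁ a2 a3) * (r₁ a1 b1 * r₁ a2 b1 * r₁ a3 b1)) ^ 1 :=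
          ih1.trans_eq (by ring)
    have hsub : r₁ a1 a2 * r₁ a2 a3 ≤ r₁ a1 a2 * r₁ a1 a3 * r₁ a2 a3 := by
      have hx : 0 ≤ r₁ a1 a2 * r₁ a2 a3 := (mul_nonneg (h0 _ _) (h0 _ _))
      have hrest : 1 ≤ r₁ a1 a3 := (h1 _ _)
      calc r₁ a1 a2 * r₁ a2 a3
          _ ≤ (r₁ a1 a2 * r₁ a2 a3) * (r₁ a1 a3) := le_mul_of_one_le_right hx hrest
          _ = r₁ a1 a2 * r₁ a1 a3 * r₁ a2 a3 := by ring
    have hch : r₁ a1 b1 * r₁ a3 b1 ≤ (r₁ a1 a2 * r₁ a2 b1) * (r₁ a2 a3 * r₁ a2 b1) :=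
      (mul_le_mul (hm00 a1 a2 b1) (hm10 a3 a2 b1) (h0 _ _) (mul_nonneg (h0 _ _) (h0 _ _)))
    have hPbE : r₁ a1 b1 * r₁ a2 b1 * r₁ a3 b1 ≤ r₁ a2 b1 ^ 3 * (r₁ a1 a2 * r₁ a1 a3 * r₁ a2 a3) := by
      calc r₁ a1 b1 * r₁ a2 b1 * r₁ a3 b1
          _ = r₁ a2 b1 * (r₁ a1 b1 * r₁ a3 b1) := by ring
          _ ≤ r₁ a2 b1 * ((r₁ a1 a2 * r₁ a2 b1) * (r₁ a2 a3 * r₁ a2 b1)) := mul_le_mul_of_nonneg_left hch (h0 _ _)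
          _ = r₁ a2 b1 ^ 3 * (r₁ a1 a2 * r₁ a2 a3) := by ring
          _ ≤ r₁ a2 b1 ^ 3 * (r₁ a1 a2 * r₁ a1 a3 * r₁ a2 a3) := mul_le_mul_of_nonneg_left hsub (pow_nonneg (h0 _ _) _)
    have hs := step ht (h1 a2 b1) (one_le_mul_of_one_le_of_one_le (one_le_mul_of_one_le_of_one_le (h1 _ _) (h1 _ _)) (h1 _ _)) (mul_nonneg
          (mul_nonneg (h0 _ _) (h0 _ _)) (h0 _ _)) h (by norm_num : 3 * (1 + 1) ≤ 8) hPbE ih'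
    calc t ^ 2 * (r₁ a1 b1 * r₁ a2 b1 * r₁ a3 b1 * r₁ a1 b2 * r₁ a2 b2 * r₁ a3 b2 * r₁ b1 b2)
        _ = t ^ (1 + 1) * ((r₁ a1 b1 * r₁ a2 b1 * r₁ a3 b1) * (r₁ a1 b2 * r₁ a2 b2 * r₁ a3 b2 * r₁ b1 b2)) := by ring
        _ ≤ _ := hs
        _ = (r₁ a1 a2 * r₁ a1 a3 * r₁ a2 a3) ^ 3 := by norm_num
  · -- strong pair (a3,b1)
    have ih' : t ^ 1 * (r₁ a1 b2 * r₁ a2 b2 * r₁ a3 b2 * r₁ b1 b2) ≤ ((r₁ a1 a2 * r₁ a1 a3 * r₁ a2 a3) * (r₁ a1 b1 * r₁ a2 b1 * r₁ a3 b1)) ^ 1 :=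
          ih1.trans_eq (by ring)
    have hsub : r₁ a1 a3 * r₁ a2 a3 ≤ r₁ a1 a2 * r₁ a1 a3 * r₁ a2 a3 := by
      have hx : 0 ≤ r₁ a1 a3 * r₁ a2 a3 := (mul_nonneg (h0 _ _) (h0 _ _))
      have hrest : 1 ≤ r₁ a1 a2 := (h1 _ _)
      calc r₁ a1 a3 * r₁ a2 a3
          _ ≤ (r₁ a1 a3 * r₁ a2 a3) * (r₁ a1 a2) := le_mul_of_one_le_right hx hrest
          _ = r₁ a1 a2 * r₁ a1 a3 * r₁ a2 a3 := by ring
    have hch : r₁ a1 b1 * r₁ a2 b1 ≤ (r₁ a1 a3 * r₁ a3 b1) * (r₁ a2 a3 * r₁ a3 b1) :=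
      (mul_le_mul (hm00 a1 a3 b1) (hm00 a2 a3 b1) (h0 _ _) (mul_nonneg (h0 _ _) (h0 _ _)))
    have hPbE : r₁ a1 b1 * r₁ a2 b1 * r₁ a3 b1 ≤ r₁ a3 b1 ^ 3 * (r₁ a1 a2 * r₁ a1 a3 * r₁ a2 a3) := by
      calc r₁ a1 b1 * r₁ a2 b1 * r₁ a3 b1
          _ = r₁ a3 b1 * (r₁ a1 b1 * r₁ a2 b1) := by ring
          _ ≤ r₁ a3 b1 * ((r₁ a1 a3 * r₁ a3 b1) * (r₁ a2 a3 * r₁ a3 b1)) := mul_le_mul_of_nonneg_left hch (h0 _ _)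
          _ = r₁ a3 b1 ^ 3 * (r₁ a1 a3 * r₁ a2 a3) := by ring
          _ ≤ r₁ a3 b1 ^ 3 * (r₁ a1 a2 * r₁ a1 a3 * r₁ a2 a3) := mul_le_mul_of_nonneg_left hsub (pow_nonneg (h0 _ _) _)
    have hs := step ht (h1 a3 b1) (one_le_mul_of_one_le_of_one_le (one_le_mul_of_one_le_of_one_le (h1 _ _) (h1 _ _)) (h1 _ _)) (mul_nonneg
          (mul_nonneg (h0 _ _) (h0 _ _)) (h0 _ _)) h (by norm_num : 3 * (1 + 1) ≤ 8) hPbE ih'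
    calc t ^ 2 * (r₁ a1 b1 * r₁ a2 b1 * r₁ a3 b1 * r₁ a1 b2 * r₁ a2 b2 * r₁ a3 b2 * r₁ b1 b2)
        _ = t ^ (1 + 1) * ((r₁ a1 b1 * r₁ a2 b1 * r₁ a3 b1) * (r₁ a1 b2 * r₁ a2 b2 * r₁ a3 b2 * r₁ b1 b2)) := by ring
        _ ≤ _ := hs
        _ = (r₁ a1 a2 * r₁ a1 a3 * r₁ a2 a3) ^ 3 := by norm_num
  · -- strong pair (a1,b2)
    have ih := ih2
    rw [hsymm b2 b1] at ih
    have ih' : t ^ 1 * (r₁ a1 b1 * r₁ a2 b1 * r₁ a3 b1 * r₁ b1 b2) ≤ ((r₁ a1 a2 * r₁ a1 a3 * r₁ a2 a3) * (r₁ a1 b2 * r₁ a2 b2 * r₁ a3 b2)) ^ 1 :=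
          ih.trans_eq (by ring)
    have hsub : r₁ a1 a2 * r₁ a1 a3 ≤ r₁ a1 a2 * r₁ a1 a3 * r₁ a2 a3 := by
      have hx : 0 ≤ r₁ a1 a2 * r₁ a1 a3 := (mul_nonneg (h0 _ _) (h0 _ _))
      have hrest : 1 ≤ r₁ a2 a3 := (h1 _ _)
      calc r₁ a1 a2 * r₁ a1 a3
          _ ≤ (r₁ a1 a2 * r₁ a1 a3) * (r₁ a2 a3) := le_mul_of_one_le_right hx hrest
          _ = r₁ a1 a2 * r₁ a1 a3 * r₁ a2 a3 := by ring
    have hch : r₁ a2 b2 * r₁ a3 b2 ≤ (r₁ a1 a2 * r₁ a1 b2) * (r₁ a1 a3 * r₁ a1 b2) :=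
      (mul_le_mul (hm10 a2 a1 b2) (hm10 a3 a1 b2) (h0 _ _) (mul_nonneg (h0 _ _) (h0 _ _)))
    have hPbE : r₁ a1 b2 * r₁ a2 b2 * r₁ a3 b2 ≤ r₁ a1 b2 ^ 3 * (r₁ a1 a2 * r₁ a1 a3 * r₁ a2 a3) := by
      calc r₁ a1 b2 * r₁ a2 b2 * r₁ a3 b2
          _ = r₁ a1 b2 * (r₁ a2 b2 * r₁ a3 b2) := by ring
          _ ≤ r₁ a1 b2 * ((r₁ a1 a2 * r₁ a1 b2) * (r₁ a1 a3 * r₁ a1 b2)) := mul_le_mul_of_nonneg_left hch (h0 _ _)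
          _ = r₁ a1 b2 ^ 3 * (r₁ a1 a2 * r₁ a1 a3) := by ring
          _ ≤ r₁ a1 b2 ^ 3 * (r₁ a1 a2 * r₁ a1 a3 * r₁ a2 a3) := mul_le_mul_of_nonneg_left hsub (pow_nonneg (h0 _ _) _)
    have hs := step ht (h1 a1 b2) (one_le_mul_of_one_le_of_one_le (one_le_mul_of_one_le_of_one_le (h1 _ _) (h1 _ _)) (h1 _ _)) (mul_nonneg
          (mul_nonneg (h0 _ _) (h0 _ _)) (h0 _ _)) h (by norm_num : 3 * (1 + 1) ≤ 8) hPbE ih'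
    calc t ^ 2 * (r₁ a1 b1 * r₁ a2 b1 * r₁ a3 b1 * r₁ a1 b2 * r₁ a2 b2 * r₁ a3 b2 * r₁ b1 b2)
        _ = t ^ (1 + 1) * ((r₁ a1 b2 * r₁ a2 b2 * r₁ a3 b2) * (r₁ a1 b1 * r₁ a2 b1 * r₁ a3 b1 * r₁ b1 b2)) := by ring
        _ ≤ _ := hs
        _ = (r₁ a1 a2 * r₁ a1 a3 * r₁ a2 a3) ^ 3 := by norm_num
  · -- strong pair (a2,b2)
    have ih := ih2
    rw [hsymm b2 b1] at ih
    have ih' : t ^ 1 * (r₁ a1 b1 * r₁ a2 b1 * r₁ a3 b1 * r₁ b1 b2) ≤ ((r₁ a1 a2 * r₁ a1 a3 * r₁ a2 a3) * (r₁ a1 b2 * r₁ a2 b2 * r₁ a3 b2)) ^ 1 :=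
          ih.trans_eq (by ring)
    have hsub : r₁ a1 a2 * r₁ a2 a3 ≤ r₁ a1 a2 * r₁ a1 a3 * r₁ a2 a3 := by
      have hx : 0 ≤ r₁ a1 a2 * r₁ a2 a3 := (mul_nonneg (h0 _ _) (h0 _ _))
      have hrest : 1 ≤ r₁ a1 a3 := (h1 _ _)
      calc r₁ a1 a2 * r₁ a2 a3
          _ ≤ (r₁ a1 a2 * r₁ a2 a3) * (r₁ a1 a3) := le_mul_of_one_le_right hx hrest
          _ = r₁ a1 a2 * r₁ a1 a3 * r₁ a2 a3 := by ring
    have hch : r₁ a1 b2 * r₁ a3 b2 ≤ (r₁ a1 a2 * r₁ a2 b2) * (r₁ a2 a3 * r₁ a2 b2) :=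
      (mul_le_mul (hm00 a1 a2 b2) (hm10 a3 a2 b2) (h0 _ _) (mul_nonneg (h0 _ _) (h0 _ _)))
    have hPbE : r₁ a1 b2 * r₁ a2 b2 * r₁ a3 b2 ≤ r₁ a2 b2 ^ 3 * (r₁ a1 a2 * r₁ a1 a3 * r₁ a2 a3) := by
      calc r₁ a1 b2 * r₁ a2 b2 * r₁ a3 b2
          _ = r₁ a2 b2 * (r₁ a1 b2 * r₁ a3 b2) := by ring
          _ ≤ r₁ a2 b2 * ((r₁ a1 a2 * r₁ a2 b2) * (r₁ a2 a3 * r₁ a2 b2)) := mul_le_mul_of_nonneg_left hch (h0 _ _)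
          _ = r₁ a2 b2 ^ 3 * (r₁ a1 a2 * r₁ a2 a3) := by ring
          _ ≤ r₁ a2 b2 ^ 3 * (r₁ a1 a2 * r₁ a1 a3 * r₁ a2 a3) := mul_le_mul_of_nonneg_left hsub (pow_nonneg (h0 _ _) _)
    have hs := step ht (h1 a2 b2) (one_le_mul_of_one_le_of_one_le (one_le_mul_of_one_le_of_one_le (h1 _ _) (h1 _ _)) (h1 _ _)) (mul_nonneg
          (mul_nonneg (h0 _ _) (h0 _ _)) (h0 _ _)) h (by norm_num : 3 * (1 + 1) ≤ 8) hPbE ih'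
    calc t ^ 2 * (r₁ a1 b1 * r₁ a2 b1 * r₁ a3 b1 * r₁ a1 b2 * r₁ a2 b2 * r₁ a3 b2 * r₁ b1 b2)
        _ = t ^ (1 + 1) * ((r₁ a1 b2 * r₁ a2 b2 * r₁ a3 b2) * (r₁ a1 b1 * r₁ a2 b1 * r₁ a3 b1 * r₁ b1 b2)) := by ring
        _ ≤ _ := hs
        _ = (r₁ a1 a2 * r₁ a1 a3 * r₁ a2 a3) ^ 3 := by norm_num
  · -- strong pair (a3,b2)
    have ih := ih2
    rw [hsymm b2 b1] at ih
    have ih' : t ^ 1 * (r₁ a1 b1 * r₁ a2 b1 * r₁ a3 b1 * r₁ b1 b2) ≤ ((r₁ a1 a2 * r₁ a1 a3 * r₁ a2 a3) * (r₁ a1 b2 * r₁ a2 b2 * r₁ a3 b2)) ^ 1 :=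
          ih.trans_eq (by ring)
    have hsub : r₁ a1 a3 * r₁ a2 a3 ≤ r₁ a1 a2 * r₁ a1 a3 * r₁ a2 a3 := by
      have hx : 0 ≤ r₁ a1 a3 * r₁ a2 a3 := (mul_nonneg (h0 _ _) (h0 _ _))
      have hrest : 1 ≤ r₁ a1 a2 := (h1 _ _)
      calc r₁ a1 a3 * r₁ a2 a3
          _ ≤ (r₁ a1 a3 * r₁ a2 a3) * (r₁ a1 a2) := le_mul_of_one_le_right hx hrest
          _ = r₁ a1 a2 * r₁ a1 a3 * r₁ a2 a3 := by ring
    have hch : r₁ a1 b2 * r₁ a2 b2 ≤ (r₁ a1 a3 * r₁ a3 b2) * (r₁ a2 a3 * r₁ a3 b2) :=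
      (mul_le_mul (hm00 a1 a3 b2) (hm00 a2 a3 b2) (h0 _ _) (mul_nonneg (h0 _ _) (h0 _ _)))
    have hPbE : r₁ a1 b2 * r₁ a2 b2 * r₁ a3 b2 ≤ r₁ a3 b2 ^ 3 * (r₁ a1 a2 * r₁ a1 a3 * r₁ a2 a3) := by
      calc r₁ a1 b2 * r₁ a2 b2 * r₁ a3 b2
          _ = r₁ a3 b2 * (r₁ a1 b2 * r₁ a2 b2) := by ring
          _ ≤ r₁ a3 b2 * ((r₁ a1 a3 * r₁ a3 b2) * (r₁ a2 a3 * r₁ a3 b2)) := mul_le_mul_of_nonneg_left hch (h0 _ _)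
          _ = r₁ a3 b2 ^ 3 * (r₁ a1 a3 * r₁ a2 a3) := by ring
          _ ≤ r₁ a3 b2 ^ 3 * (r₁ a1 a2 * r₁ a1 a3 * r₁ a2 a3) := mul_le_mul_of_nonneg_left hsub (pow_nonneg (h0 _ _) _)
    have hs := step ht (h1 a3 b2) (one_le_mul_of_one_le_of_one_le (one_le_mul_of_one_le_of_one_le (h1 _ _) (h1 _ _)) (h1 _ _)) (mul_nonneg
          (mul_nonneg (h0 _ _) (h0 _ _)) (h0 _ _)) h (by norm_num : 3 * (1 + 1) ≤ 8) hPbE ih'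
    calc t ^ 2 * (r₁ a1 b1 * r₁ a2 b1 * r₁ a3 b1 * r₁ a1 b2 * r₁ a2 b2 * r₁ a3 b2 * r₁ b1 b2)
        _ = t ^ (1 + 1) * ((r₁ a1 b2 * r₁ a2 b2 * r₁ a3 b2) * (r₁ a1 b1 * r₁ a2 b1 * r₁ a3 b1 * r₁ b1 b2)) := by ring
        _ ≤ _ := hs
        _ = (r₁ a1 a2 * r₁ a1 a3 * r₁ a2 a3) ^ 3 := by norm_num


/-! ## §3. Toy -/

/-- Toy (the exponent budget): `|S|·(N_{|S|+1}+1)` is `4·1, 3·2, 2·4, 1·8 ≤ 8` at `|S| = 4, 3, 2, 1`. -/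
example : 4 * (0 + 1) ≤ 8 ∧ 3 * (1 + 1) ≤ 8 ∧ 2 * (3 + 1) ≤ 8 ∧ 1 * (7 + 1) ≤ 8 := by norm_num

end Summit.QuantumFields.BalabanUV.T4Continuum.NE7b.SupFivePointCutFullGraph
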